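import Summits.ABC.IUTFork.Cor312HullStableDHVol
import HarnessLib

/-!
# [IUTchIII] Cor. 3.12, statement — the LOCAL Θ-VOLUME of `^{n,∘}𝒰_{i+1,p}` at an unramified odd prime for the sharp
# idele boxes: `−(log p / [F:ℚ]^{j+1}) · Σ_{v⃗} min_a ord_p(t_{Θ,i+1,v_a})` — the (Ind1)-symmetrisation in numbers

PROOF-ONLY sequel (abc-iut cell, Cor. 3.12 sub-crew, seat abc-iut-c312-5, gen 4) of `Cor312HullStableDHVol`; TAKES NO
SIDE on [IUTchIII] Cor. 3.12; no definition, no `Prop` fact. There, at c312-5's sharp setting of record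
(`Real.settingDHVolSharp`, abc-iut-c312-3 p419746: Θ-boxes `ι_j(t_{Θ,j,v_j})·(R_I)^∼`, Dupuy–Hilado §3.9) and a packet
`(i+1, p)` with `p` odd, `p ∤ disc(F)`, Θ-ideles of norms `‖t_{Θ,i+1,v}‖ = ‖p^{m(v)}‖` (automatic), the holomorphic hull of
the union of ALL possible images was COMPUTED: `^{n,∘}𝒰_{i+1,p} = e⁻¹(Π_{v⃗} p^{k(v⃗)}·I_{v⃗})`, `k(v⃗) = min_a m(v_a)`
(`thetaHull_settingDHVolSharp_eq_of_zpow`). THIS FILE reads off the NUMBER [IUTchIII] Cor. 3.12 attaches to it (kurims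
`paper:url-4b091feeb646` p. 174 l. 11–16: "the procession-normalized mono-analytic log-volume of the holomorphic hull"):

* `logvol_latticePkS_ppow_settingDHVol` — in the verbatim container ([IUTchIII] Rmk. 3.1.1 (ii)(iii): weighted sum over
  the summands `v⃗` of Dupuy–Hilado's normalised log-measures, weight `1/[F:ℚ]^{j+1}` — abc-iut-c312-5 `weightDH`;
  NORMALISATION CAVEAT F-c312-1-g5-1: this is print's weight applied to the NORMALISED measure, see `C312-RESIDUALS §0`)
  the scaled lattice `e⁻¹(Π_{v⃗} p^{k(v⃗)}·I_{v⃗})` has log-volume `Σ_{v⃗} w·(−k(v⃗)·log p)` ("Mochizuki normalized":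
  `log μ̄(p^k·(R_I)^∼) = −k·log p`, campaign-S `packetLogμ_ppow_smul`);
* **`thetaLocal_settingDHVolSharp_eq_of_zpow`** — hence the local Θ-volume at `(i+1, p)` of the sharp setting of record
  IS `Σ_{v⃗} (1/[F:ℚ]^{i+2})·(−min_a m(v_a)·log p)`, while the (Ind3)-box itself has `Σ_{v⃗} (1/[F:ℚ]^{i+2})·
  (−m(v_{i+1})·log p)` (abc-iut-c312-3 `logvol_thetaRegion3_sharp_inr`): the (Ind1)-symmetrisation of
  `Cor312HullStableDHVol` LOWERS every summand exponent to the minimum over the capsule — the exact size of the hull's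
  excess over the box at a prime under `S` in the typed model (`logvol_thetaRegion3_le_thetaLocal_sharp`: box ≤ hull).
[claim: Mochizuki2012, status: disputed] for the quoted quantities; [cite: DupuyHilado2025, §3.9, Rmk. 3.5.4];
[cite: Mochizuki2012, IUTchIII Rmk. 3.1.1 (ii) p. 94]. Deliberately NOT here: the global sum `−|log(Θ)|`, any judgement.
-/

noncomputable section

open Set Function NumberField IsDedekindDomain
open scoped Pointwise

namespace Summit.ABC

namespace IUTFork

namespace Thm311

namespace Real

open Cor312 Cor312Vol Literature.IUT.LogThetaLattice Literature.IUT.LogVolume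

variable {F : Type} [Field F] [NumberField F] (X : PilotData F) {logv : PadicLogs F} (hlog : LogvAnalytic logv)

variable (M : Type) [Field M] [NumberField M]
  (archPk : ∀ (j : (thetaIndex X).Label) (vQ : (thetaIndex X).VQ), Set ((logShellsDH X logv).Packet j vQ))
  (archSub : ∀ (j : (thetaIndex X).Label) (v : (thetaIndex X).V),
    Set ((logShellsDH X logv).Packet j ((thetaIndex X).over v)))
  (Ψ : ℤ → ∀ v : (thetaIndex X).V, v ∈ (thetaIndex X).Vbad → Set ((logShellsDH X logv).StarPacket v))
  (act : ℤ → ∀ v : (thetaIndex X).V, v ∈ (thetaIndex X).Vbad →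
    (logShellsDH X logv).StarPacket v → Module.End ℚ ((logShellsDH X logv).StarPacket v))
  (Mmod : ℤ → ∀ j : (thetaIndex X).LabelStar, Set ((logShellsDH X logv).GlobalPacket j.1))
  (region : ℤ → ∀ j : (thetaIndex X).LabelStar, FinDivisor M → ∀ vQ : (thetaIndex X).VQ,
    Set ((logShellsDH X logv).Packet j.1 vQ))
  (n : ℤ)

/-- **The verbatim log-volume of a `p`-power scaled lattice**: `μ^log(e⁻¹(Π_{v⃗} p^{k(v⃗)}·I_{v⃗})) = Σ_{v⃗} w·(−k(v⃗)·log p)`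
at an unramified odd `p` (`I_{v⃗} = (R_{v⃗})^∼` there; "Mochizuki normalized" `log μ̄(p^k·(R)^∼) = −k·log p`).
[cite: DupuyHilado2025, Rmk. 3.5.4] -/
theorem logvol_latticePkS_ppow_settingDHVol (i : Fin (thetaIndex X).lstar) (pp : Nat.Primes) [Fact (pp : ℕ).Prime]
    (hp2 : 2 < (pp : ℕ)) (hdisc : ¬ ((pp : ℕ) : ℤ) ∣ NumberField.discr F)
    (k : ((thetaIndex X).Caps (Setting.labelSucc i) → (thetaIndex X).Fibre (.inr pp)) → ℤ) :
    ((situationDHVol X hlog M archPk archSub Ψ act Mmod region).D n).logvol (Setting.labelSucc i) (.inr pp)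
        ((presAt X hlog pp).latticePkS (Setting.labelSucc i) fun e => ((pp : ℕ) : ℚ_[pp]) ^ k e) =
      ∑ e : (presAt X hlog pp).toLocalPieces.E (Setting.labelSucc i),
        weightDH X (Setting.labelSucc i) * (-(k e * Real.log (pp : ℕ))) := by
  have hj := two_le_card_caps_labelSucc X i
  have he := absRamificationIdx_presAt_eq_one X hlog pp hdisc
  rw [(presAt X hlog pp).latticePkS_eq_of_unramified hp2 hj he]
  have hadm : ∀ e : (thetaIndex X).Caps (Setting.labelSucc i) → (thetaIndex X).Fibre (.inr pp),
      PacketAdm (pp : ℕ) ((presAt X hlog pp).kk e)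
        ((((pp : ℕ) : ℚ_[pp]) ^ k e) • (normalizedPacket (pp : ℕ) ((presAt X hlog pp).kk e) :
          Set ((presAt X hlog pp).X e))) :=
    fun e => packetAdm_const_smul (pp : ℕ) _ (zpow_ne_zero _ (Nat.cast_ne_zero.mpr pp.2.ne_zero))
      (packetAdm_normalizedPacket (pp : ℕ) _)
  have key := SummandPieces.logvol_preimage_pi (summandPiecesDH X hlog) (Setting.labelSucc i) (.inr pp)
    (R := fun e => (((pp : ℕ) : ℚ_[pp]) ^ k e) • (normalizedPacket (pp : ℕ) ((presAt X hlog pp).kk e) :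
      Set ((presAt X hlog pp).X e))) hadm
  refine (((realizes_situationDHVol X hlog M archPk archSub Ψ act Mmod region n).logvol_eq _ (.inr pp) _).trans
    key).trans (Finset.sum_congr rfl fun e _ => ?_)
  haveI : Nonempty ((thetaIndex X).Caps (Setting.labelSucc i)) := ⟨0⟩
  show weightDH X (Setting.labelSucc i) * packetLogμ (pp : ℕ) ((presAt X hlog pp).kk e) _ = _
  congr 1
  rw [smul_set_eq_algebraMap_smul (pp : ℕ) ((presAt X hlog pp).kk e)]
  show packetLogμ (pp : ℕ) ((presAt X hlog pp).kk e)
    (ppow (pp : ℕ) ((presAt X hlog pp).kk e) (k e) • (normalizedPacket (pp : ℕ) ((presAt X hlog pp).kk e) :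
      Set ((presAt X hlog pp).X e))) = _
  rw [packetLogμ_ppow_smul (pp : ℕ) _ (k e) (packetAdm_normalizedPacket (pp : ℕ) _), packetLogμ_normalizedPacket,
    add_zero]

section Sharp

variable (t : ∀ (pp : Nat.Primes) (_ : Fin X.lstar) (x : (thetaIndex X).Fibre (.inr pp)),
    haveI : Fact (pp : ℕ).Prime := ⟨pp.2⟩; kOf X pp.1 x)
  (tq : ∀ (pp : Nat.Primes) (x : (thetaIndex X).Fibre (.inr pp)),
    haveI : Fact (pp : ℕ).Prime := ⟨pp.2⟩; kOf X pp.1 x)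
  {HT : Type} {LogLink : HT → HT → Type} {IsFull : ∀ {s t : HT}, LogLink s t → Prop}
  (lat : LGPGaussianLogThetaLattice LogLink IsFull)
  {Frd : Type} {IsoF : Frd → Frd → Type} {Ob : Frd → Type} {realify : Frd → Frd} {Strip : Type}
  {IsoS : Strip → Strip → Type} {Mv : ∀ v : (thetaIndex X).V, v ∈ (thetaIndex X).Vbad → Type}
  [∀ v h, Monoid (Mv v h)]
  (sig : GlobalLGPFrobenioidSignature (thetaIndex X).lstar (thetaIndex X).V (· ∈ (thetaIndex X).Vbad)
    Frd IsoF Ob realify Strip IsoS Mv)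
  (split : SplittingMonoids Mv) {ObΔ : Type} {N : ∀ v : (thetaIndex X).V, v ∈ (thetaIndex X).Vbad → Type}
  [∀ v h, Monoid (N v h)] (qData : QPilotData ObΔ N)

/-- **The local Θ-volume of the sharp setting of record at an unramified odd packet, in closed form**:
`μ^log(^{n,∘}𝒰_{i+1,p}) = Σ_{v⃗} (1/[F:ℚ]^{i+2})·(−min_a m(v_a)·log p)` when `‖t_{Θ,i+1,v}‖ = ‖p^{m(v)}‖` (automatic at an
unramified place) — the exponent of the Θ-idele at the LAST coordinate is replaced by the MINIMUM over the capsule.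
[cite: DupuyHilado2025, §3.9, Rmk. 3.5.4] -/
theorem thetaLocal_settingDHVolSharp_eq_of_zpow (ht0 : ∀ pp i x, t pp i x ≠ 0) (htq0 : ∀ pp x, tq pp x ≠ 0)
    (htq1 : ∀ (pp : Nat.Primes) (x : (thetaIndex X).Fibre (.inr pp)),
      haveI : Fact (pp : ℕ).Prime := ⟨pp.2⟩; placeOf X pp.1 x ∉ X.S → ‖tq pp x‖ = 1)
    (i : Fin (thetaIndex X).lstar) (pp : Nat.Primes) [Fact (pp : ℕ).Prime] (hp2 : 2 < (pp : ℕ))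
    (hdisc : ¬ ((pp : ℕ) : ℤ) ∣ NumberField.discr F)
    (m : (thetaIndex X).Fibre (.inr pp) → ℤ) (hm : ∀ x, ‖t pp i x‖ = ‖((pp : ℕ) : ℚ_[pp]) ^ m x‖) :
    (settingDHVolSharp X hlog M archPk archSub Ψ act Mmod region n lat sig split qData tq t htq0
        htq1).thetaLocal (Setting.labelSucc i) (.inr pp) =
      ((∑ e : (presAt X hlog pp).toLocalPieces.E (Setting.labelSucc i),
        weightDH X (Setting.labelSucc i) *
          (-(Finset.univ.inf' Finset.univ_nonempty (fun a => m (e a)) * Real.log (pp : ℕ))) : ℝ) : WithTop ℝ) := by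
  haveI : Nonempty ((thetaIndex X).Caps (Setting.labelSucc i)) := ⟨0⟩
  have hHD := hullDefined_settingDHVolSharp_of_unramified X hlog t tq M archPk archSub Ψ act Mmod region n lat sig split
    qData ht0 htq0 htq1 i pp hdisc
  unfold Setting.thetaLocal
  rw [if_pos hHD, thetaHull_settingDHVolSharp_eq_of_zpow X hlog t tq M archPk archSub Ψ act Mmod region n lat sig split
    qData ht0 htq0 htq1 i pp hp2 hdisc m hm]
  congr 1
  have h := logvol_latticePkS_ppow_settingDHVol X hlog M archPk archSub Ψ act Mmod region n i pp hp2 hdisc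
    fun e => Finset.univ.inf' Finset.univ_nonempty fun a => m (e a)
  rw [settingDHVolSharp_n]
  exact h

/-- **Box ≤ hull at such a packet, in numbers**: the (Ind3)-region (the sharp box, exponents `m(v_{i+1})`) has
log-volume at most that of `^{n,∘}𝒰_{i+1,p}` (exponents `min_a m(v_a)`). [cite: DupuyHilado2025, §3.9] -/
theorem logvol_thetaRegion3_le_thetaLocal_sharp (ht0 : ∀ pp i x, t pp i x ≠ 0) (htq0 : ∀ pp x, tq pp x ≠ 0)
    (htq1 : ∀ (pp : Nat.Primes) (x : (thetaIndex X).Fibre (.inr pp)),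
      haveI : Fact (pp : ℕ).Prime := ⟨pp.2⟩; placeOf X pp.1 x ∉ X.S → ‖tq pp x‖ = 1)
    (i : Fin (thetaIndex X).lstar) (pp : Nat.Primes) [Fact (pp : ℕ).Prime] (hp2 : 2 < (pp : ℕ))
    (hdisc : ¬ ((pp : ℕ) : ℤ) ∣ NumberField.discr F)
    (m : (thetaIndex X).Fibre (.inr pp) → ℤ) (hm : ∀ x, ‖t pp i x‖ = ‖((pp : ℕ) : ℚ_[pp]) ^ m x‖) :
    ((((situationDHVol X hlog M archPk archSub Ψ act Mmod region).D n).logvol (Setting.labelSucc i) (.inr pp)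
        ((settingDHVolSharp X hlog M archPk archSub Ψ act Mmod region n lat sig split qData tq t htq0
          htq1).thetaRegion3 (Setting.labelSucc i) (.inr pp)) : ℝ) : WithTop ℝ) ≤
      (settingDHVolSharp X hlog M archPk archSub Ψ act Mmod region n lat sig split qData tq t htq0
        htq1).thetaLocal (Setting.labelSucc i) (.inr pp) := by
  haveI : Nonempty ((thetaIndex X).Caps (Setting.labelSucc i)) := ⟨0⟩
  have hp1 : 0 ≤ Real.log (pp : ℕ) := Real.log_nonneg (by exact_mod_cast pp.2.one_lt.le)
  have hw : 0 ≤ weightDH X (Setting.labelSucc i) := weightDH_nonneg X _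
  rw [thetaLocal_settingDHVolSharp_eq_of_zpow X hlog M archPk archSub Ψ act Mmod region n t tq lat sig split qData ht0 htq0
    htq1 i pp hp2 hdisc m hm, WithTop.coe_le_coe]
  show ((situationDHVol X hlog M archPk archSub Ψ act Mmod region).D n).logvol (Setting.labelSucc i) (.inr pp)
      ((settingDHVol X hlog M archPk archSub Ψ act Mmod region n lat sig split qData
        (fun _ _ => thetaBoxDH X hlog (sharpBoxDH X hlog t)) (fun _ => qCentreDH X hlog tq)
          (qCentreDH_ne_zero X hlog tq htq0)
          (finite_support_logvol_qRegion X hlog M archPk archSub Ψ act Mmod region n tq htq0 htq1)).thetaRegion3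
        (Setting.labelSucc i) (.inr pp)) ≤ _
  rw [logvol_thetaRegion3_sharp_inr X hlog M archPk archSub Ψ act Mmod region n lat sig split qData _ _ _ t ht0 i pp]
  refine Finset.sum_le_sum fun e _ => mul_le_mul_of_nonneg_left ?_ hw
  rw [hm, norm_zpow, Padic.norm_p, Real.log_zpow, Real.log_inv, mul_neg]
  exact neg_le_neg (mul_le_mul_of_nonneg_right
    (by exact_mod_cast Finset.inf'_le (fun a => m (e a)) (Finset.mem_univ (Fin.last _))) hp1)

end Sharp

end Real

end Thm311

end IUTFork

end Summit.ABC

end
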